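import Literature.Analysis.PDE.Wave1DFarConeDuhamel
import Literature.Analysis.PDE.Wave1DFarComparisonLimits
import Literature.Analysis.PDE.FarKernelSpanLemmas
import HarnessLib

/-!
# Far-cone comparison with a model wave at apex `0` when the data sit far out

Analysis/PDE support file (everything proved, no definitions). Let `V, V₀ ≥ 0` be continuous
potentials on `ℝ` which are close FAR OUT only: for `x ≥ X > 0`,

  `(V₀ − V)² ≤ D² x⁻³ V`   and   `(1 − κ) V₀ ≤ V`   (`0 ≤ κ < 1`).

Let `ψ` be a global `C²` solution of `ψ_tt − ψ_xx + Vψ = 0` of energy `≤ E` at all times which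
vanishes on the backward region `{x + |t| < R₀}` (domain of dependence for data supported in
`[R₀, ∞)`), `R₀ ≥ 2X`, and let `φ` be a global `C²` function solving the MODEL equation
`φ_tt − φ_xx + V₀φ = 0` on the closed cone `{|t| ≤ x}` with the same Cauchy data as `ψ` on `x > 0`.
Although the apex `x = 0` of the cone is far inside the region where `V` and `V₀` are unrelated,
finite speed of propagation keeps the Duhamel source `(V₀ − V)ψ` of `w = ψ − φ` at `x ≥ R₀/2`, where
it is `O(x^{-3/2})` in `L²`; the far-cone Duhamel bound (`Wave1DFarConeDuhamel`) with the majorant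
`m(τ) = 2√2·D√E·(R₀/2 + |τ|)^{-3/2}` gives `∫_{x>|t|} e_{V₀}[w](t) ≤ 256 D²E/R₀`, whence for all
`t ≥ 0` (`far_model_comparison_forward`) and all `t ≤ 0` (`…_backward`)

  `∫⁻_{x>|t|} e_{V₀}[φ](t) ≤ (2/(1−κ)) ∫⁻_{x>|t|} e_V[ψ](t) + 512 D² E / R₀`,

and the same inequality between the `liminf`s at `t → ±∞` (`far_model_comparison_liminf_atTop/atBot`).
This is the transfer step of the per-mode far-side half-share of the windowed shell channels
(route PhotonSphereChannels, crux `WindowedShellChannels`, stmt-FinalStateConjecture-14085, stub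
`stub_farHalfShare`): `V` the Regge–Wheeler potential on the tortoise line, `V₀ = ℓ(ℓ+1)/x²` (smoothly
extended below `x = ½`), `φ` the regular exact inverse-square wave cut off below `x = 1`, for which the
apex-`0` exterior-energy identity `E ≤ L⁺(0) + L⁻(0)` holds (`InverseSquareExteriorEnergyIdentity`).
Folklore (Duhamel + domain of dependence; L. C. Evans, *PDE*, §2.4.3).
-/

noncomputable section

namespace Literature.Analysis.PDE

open MeasureTheory Set Filter Topology intervalIntegral Real Literature.Analysis.Calculus
open scoped ENNReal

variable {V V₀ : ℝ → ℝ} {ψ φ : ℝ → ℝ → ℝ}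

/-- A function of `(t, x)` vanishing on the open backward region `{x + |t| < R₀}` has vanishing
first partials there. [folklore] -/
theorem wave1D_derivs_eq_zero_of_vanish {R₀ : ℝ} (hvan : ∀ t x, x + |t| < R₀ → ψ t x = 0)
    {t x : ℝ} (h : x + |t| < R₀) :
    deriv (fun τ => ψ τ x) t = 0 ∧ deriv (ψ t) x = 0 := by
  constructor
  · have hev : (fun τ => ψ τ x) =ᶠ[𝓝 t] fun _ => (0 : ℝ) := by
      have ho : IsOpen {τ : ℝ | x + |τ| < R₀} := isOpen_lt (by fun_prop) continuous_const
      filter_upwards [ho.mem_nhds (by exact h)] with τ hτ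
      exact hvan τ x hτ
    rw [hev.deriv_eq]; simp
  · have hev : (ψ t) =ᶠ[𝓝 x] fun _ => (0 : ℝ) := by
      have ho : IsOpen {y : ℝ | y + |t| < R₀} := isOpen_lt (by fun_prop) continuous_const
      filter_upwards [ho.mem_nhds (by exact h)] with y hy
      exact hvan t y hy
    rw [hev.deriv_eq]; simp

/-- Algebra: `2^{-3} = 1/8` for real powers. [folklore] -/
theorem two_rpow_neg_three : (2 : ℝ) ^ (-(3 : ℝ)) = 1 / 8 := by
  rw [Real.rpow_neg (by norm_num), show (3 : ℝ) = ((3 : ℕ) : ℝ) by norm_num, Real.rpow_natCast]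
  norm_num

/-- Pointwise vanishing of the solution's energy density on the backward region meets the cone:
for `0 ≤ t < x` either `x ≥ X` or `e_V[ψ](t,x) = 0`, so `e_{V₀}[ψ] ≤ (1−κ)⁻¹ e_V[ψ]` on the whole
far half-line `x > t` (`R₀ ≥ 2X`, `(1−κ)V₀ ≤ V` beyond `X`, `0 ≤ κ < 1`). [folklore] -/
theorem far_model_density_le {X R₀ κ : ℝ} (hXR : 2 * X ≤ R₀)
    (hvan : ∀ t x, x + |t| < R₀ → ψ t x = 0) (hκ0 : 0 ≤ κ) (hκ1 : κ < 1)
    (hlow : ∀ x, X ≤ x → (1 - κ) * V₀ x ≤ V x) {t x : ℝ} (ht : 0 ≤ t) (hx : t < x) :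
    deriv (fun s => ψ s x) t ^ 2 + deriv (ψ t) x ^ 2 + V₀ x * ψ t x ^ 2
      ≤ (1 - κ)⁻¹ * (deriv (fun s => ψ s x) t ^ 2 + deriv (ψ t) x ^ 2 + V x * ψ t x ^ 2) := by
  have hk : 0 < 1 - κ := by linarith
  have hk1 : 1 ≤ (1 - κ)⁻¹ := by rw [le_inv_comm₀ one_pos hk, inv_one]; linarith
  by_cases hfar : x + |t| < R₀
  · obtain ⟨h1, h2⟩ := wave1D_derivs_eq_zero_of_vanish hvan hfar
    rw [h1, h2, hvan t x hfar]
    simp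
  · rw [not_lt, abs_of_nonneg ht] at hfar
    have hxX : X ≤ x := by linarith
    have hVV : V₀ x ≤ (1 - κ)⁻¹ * V x := by
      rw [← div_eq_inv_mul, le_div_iff₀ hk, mul_comm]
      exact hlow x hxX
    have hkin : deriv (fun s => ψ s x) t ^ 2 + deriv (ψ t) x ^ 2
        ≤ (1 - κ)⁻¹ * (deriv (fun s => ψ s x) t ^ 2 + deriv (ψ t) x ^ 2) := by
      have h0 : 0 ≤ deriv (fun s => ψ s x) t ^ 2 + deriv (ψ t) x ^ 2 := by positivity
      nlinarith
    have hpot : V₀ x * ψ t x ^ 2 ≤ (1 - κ)⁻¹ * (V x * ψ t x ^ 2) := by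
      rw [← mul_assoc]
      exact mul_le_mul_of_nonneg_right hVV (sq_nonneg _)
    linarith

section Forward

variable (hV : Continuous V) (hV0 : ∀ x, 0 ≤ V x) (hV₀ : Continuous V₀) (hV₀0 : ∀ x, 0 ≤ V₀ x)
  (hψ : ContDiff ℝ 2 (Function.uncurry ψ))
  (hψsol : ∀ t x, iteratedDeriv 2 (fun τ => ψ τ x) t - iteratedDeriv 2 (ψ t) x + V x * ψ t x = 0)
  (hφ : ContDiff ℝ 2 (Function.uncurry φ))
  (hφsol : ∀ t x, |t| ≤ x →
    iteratedDeriv 2 (fun τ => φ τ x) t - iteratedDeriv 2 (φ t) x + V₀ x * φ t x = 0)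
  {X R₀ D κ E : ℝ} (hX : 0 < X) (hXR : 2 * X ≤ R₀) (hD : 0 ≤ D) (hκ0 : 0 ≤ κ) (hκ1 : κ < 1)
  (hE : 0 ≤ E)
  (hclose : ∀ x, X ≤ x → (V₀ x - V x) ^ 2 ≤ D ^ 2 * x ^ (-(3 : ℝ)) * V x)
  (hlow : ∀ x, X ≤ x → (1 - κ) * V₀ x ≤ V x)
  (hvan : ∀ t x, x + |t| < R₀ → ψ t x = 0)
  (hdat : ∀ x, 0 < x → φ 0 x = ψ 0 x ∧ deriv (fun τ => φ τ x) 0 = deriv (fun τ => ψ τ x) 0)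
  (hEψ : ∀ τ, ∫⁻ x, ENNReal.ofReal
    (deriv (fun s => ψ s x) τ ^ 2 + deriv (ψ τ) x ^ 2 + V x * ψ τ x ^ 2) ≤ ENNReal.ofReal E)
include hV hV0 hV₀ hV₀0 hψ hψsol hφ hφsol hX hXR hD hκ0 hκ1 hE hclose hlow hvan hdat hEψ

omit hV₀0 hψsol hφ hφsol hD hκ0 hκ1 hlow hdat in
/-- **The source on far slices.** For `τ ≥ 0` and `τ ≤ b − τ`,
`∫_τ^{b−τ} ((V₀ − V)ψ(τ))² ≤ 8 D² (R₀/2 + τ)^{-3} E`: on the slice the solution vanishes unless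
`x ≥ R₀ − τ`, so `x ≥ max(X, (R₀/2 + τ)/2)` wherever the integrand is nonzero. [folklore] -/
theorem far_model_source_sq_le {τ : ℝ} (hτ : 0 ≤ τ) (b : ℝ) (hb : τ ≤ b - τ) :
    (∫ x in τ..(b - τ), ((V₀ x - V x) * ψ τ x) ^ 2)
      ≤ 8 * D ^ 2 * (R₀ / 2 + τ) ^ (-(3 : ℝ)) * E := by
  set c : ℝ := R₀ / 2 with hc
  have hc0 : 0 < c := by rw [hc]; linarith
  have hcτ : 0 < c + τ := by linarith
  -- pointwise bound on the slice
  have hpt : ∀ x ∈ Icc τ (b - τ), ((V₀ x - V x) * ψ τ x) ^ 2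
      ≤ 8 * D ^ 2 * (c + τ) ^ (-(3 : ℝ)) * (V x * ψ τ x ^ 2) := by
    intro x hx
    by_cases hfar : x + |τ| < R₀
    · rw [hvan τ x hfar]; simp
    · rw [not_lt, abs_of_nonneg hτ] at hfar
      have hxX : X ≤ x := by
        rcases le_or_gt τ c with h | h
        · linarith [hx.1]
        · linarith [hx.1]
      have hx2 : (c + τ) / 2 ≤ x := by
        rcases le_or_gt τ c with h | h
        · linarith [hx.1]
        · linarith [hx.1]
      have hx0 : 0 < x := by linarith
      have hrp : x ^ (-(3 : ℝ)) ≤ 8 * (c + τ) ^ (-(3 : ℝ)) := by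
        calc x ^ (-(3 : ℝ)) ≤ ((c + τ) / 2) ^ (-(3 : ℝ)) :=
              rpow_le_rpow_of_nonpos (by positivity) hx2 (by norm_num)
          _ = (c + τ) ^ (-(3 : ℝ)) / (2 : ℝ) ^ (-(3 : ℝ)) :=
              div_rpow hcτ.le (by norm_num) _
          _ = 8 * (c + τ) ^ (-(3 : ℝ)) := by rw [two_rpow_neg_three]; ring
      have hVx := hV0 x
      calc ((V₀ x - V x) * ψ τ x) ^ 2 = (V₀ x - V x) ^ 2 * ψ τ x ^ 2 := by ring
        _ ≤ (D ^ 2 * x ^ (-(3 : ℝ)) * V x) * ψ τ x ^ 2 :=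
            mul_le_mul_of_nonneg_right (hclose x hxX) (sq_nonneg _)
        _ = x ^ (-(3 : ℝ)) * (D ^ 2 * (V x * ψ τ x ^ 2)) := by ring
        _ ≤ (8 * (c + τ) ^ (-(3 : ℝ))) * (D ^ 2 * (V x * ψ τ x ^ 2)) :=
            mul_le_mul_of_nonneg_right hrp (by positivity)
        _ = 8 * D ^ 2 * (c + τ) ^ (-(3 : ℝ)) * (V x * ψ τ x ^ 2) := by ring
  -- the potential energy on the slice is at most `E`
  have hce : Continuous fun x => deriv (fun s => ψ s x) τ ^ 2 + deriv (ψ τ) x ^ 2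
      + V x * ψ τ x ^ 2 :=
    (continuous_wave1D_energyDensity hV hψ).comp (continuous_const.prodMk continuous_id)
  have hcV : Continuous fun x => V x * ψ τ x ^ 2 :=
    hV.mul ((hψ.continuous.comp (continuous_const.prodMk continuous_id)).pow 2)
  have hcS : Continuous fun x => ((V₀ x - V x) * ψ τ x) ^ 2 :=
    ((hV₀.sub hV).mul (hψ.continuous.comp (continuous_const.prodMk continuous_id))).pow 2
  have hEslice : (∫ x in τ..(b - τ), (deriv (fun s => ψ s x) τ ^ 2 + deriv (ψ τ) x ^ 2
      + V x * ψ τ x ^ 2)) ≤ E := by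
    have h1 := lintegral_Ioc_wave1D_energy_eq hV hV0 hψ τ hb
    have h2 : ∫⁻ x in Ioc τ (b - τ), ENNReal.ofReal
        (deriv (fun s => ψ s x) τ ^ 2 + deriv (ψ τ) x ^ 2 + V x * ψ τ x ^ 2) ≤ ENNReal.ofReal E :=
      (setLIntegral_le_lintegral _ _).trans (hEψ τ)
    rw [h1] at h2
    exact (ENNReal.ofReal_le_ofReal_iff hE).1 h2
  have hVslice : (∫ x in τ..(b - τ), V x * ψ τ x ^ 2) ≤ E := by
    refine le_trans (intervalIntegral.integral_mono_on hb (hcV.intervalIntegrable _ _)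
      (hce.intervalIntegrable _ _) fun x _ => ?_) hEslice
    nlinarith [sq_nonneg (deriv (fun s => ψ s x) τ), sq_nonneg (deriv (ψ τ) x)]
  calc (∫ x in τ..(b - τ), ((V₀ x - V x) * ψ τ x) ^ 2)
      ≤ ∫ x in τ..(b - τ), 8 * D ^ 2 * (c + τ) ^ (-(3 : ℝ)) * (V x * ψ τ x ^ 2) :=
        intervalIntegral.integral_mono_on hb (hcS.intervalIntegrable _ _)
          ((hcV.intervalIntegrable _ _).const_mul _) hpt
    _ = 8 * D ^ 2 * (c + τ) ^ (-(3 : ℝ)) * ∫ x in τ..(b - τ), V x * ψ τ x ^ 2 :=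
        intervalIntegral.integral_const_mul _ _
    _ ≤ 8 * D ^ 2 * (c + τ) ^ (-(3 : ℝ)) * E :=
        mul_le_mul_of_nonneg_left hVslice (by positivity)

omit hκ0 hκ1 hlow in
/-- **Duhamel bound for the difference.** With `w = ψ − φ` (zero data on `x > 0`, `V₀`-source
`(V₀ − V)ψ` on the cone), for every `t ≥ 0`: `∫⁻_{x>t} e_{V₀}[w](t) ≤ 256 D² E / R₀`. [folklore] -/
theorem far_model_duhamel {t : ℝ} (ht : 0 ≤ t) :
    ∫⁻ x in Ioi t, ENNReal.ofReal
        (deriv (fun τ => ψ τ x - φ τ x) t ^ 2 + deriv (fun y => ψ t y - φ t y) x ^ 2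
          + V₀ x * (ψ t x - φ t x) ^ 2)
      ≤ ENNReal.ofReal (256 * D ^ 2 * E / R₀) := by
  set c : ℝ := R₀ / 2 with hc
  have hc0 : 0 < c := by rw [hc]; linarith
  -- the difference and its `V₀`-residual
  set w : ℝ → ℝ → ℝ := fun t x => ψ t x - φ t x with hw
  have hwC : ContDiff ℝ 2 (Function.uncurry w) := hψ.sub hφ
  set Fw : ℝ → ℝ → ℝ := fun t x =>
    iteratedDeriv 2 (fun τ => w τ x) t - iteratedDeriv 2 (w t) x + V₀ x * w t x with hFw
  have hFwc : Continuous (Function.uncurry Fw) := continuous_wave1D_residual hV₀ hwC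
  have hwsol : ∀ t x, iteratedDeriv 2 (fun τ => w τ x) t - iteratedDeriv 2 (w t) x + V₀ x * w t x
      = Fw t x := fun t x => rfl
  -- on the cone the residual is `(V₀ − V)ψ`
  have hFw_cone : ∀ τ x, |τ| ≤ x → Fw τ x = (V₀ x - V x) * ψ τ x := by
    intro τ x hx
    have e1 : iteratedDeriv 2 (fun s => w s x) τ
        = iteratedDeriv 2 (fun s => ψ s x) τ - iteratedDeriv 2 (fun s => φ s x) τ :=
      iteratedDeriv_fun_sub ((contDiff_two_slices' hψ τ x).1.contDiffAt)
        ((contDiff_two_slices' hφ τ x).1.contDiffAt)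
    have e2 : iteratedDeriv 2 (w τ) x = iteratedDeriv 2 (ψ τ) x - iteratedDeriv 2 (φ τ) x := by
      show iteratedDeriv 2 (fun y => ψ τ y - φ τ y) x = _
      exact iteratedDeriv_fun_sub ((contDiff_two_slices' hψ τ x).2.contDiffAt)
        ((contDiff_two_slices' hφ τ x).2.contDiffAt)
    have h1 := hψsol τ x
    have h2 := hφsol τ x hx
    simp only [hFw, hw]
    rw [e1, e2]
    linarith
  -- zero data on `x > 0`
  have hdψ : ∀ t x, DifferentiableAt ℝ (fun τ => ψ τ x) t :=
    fun t x => (contDiff_two_slices' hψ t x).1.differentiable (by norm_num) t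
  have hdφ : ∀ t x, DifferentiableAt ℝ (fun τ => φ τ x) t :=
    fun t x => (contDiff_two_slices' hφ t x).1.differentiable (by norm_num) t
  have hzero : ∀ x ∈ Ioi (0 : ℝ), w 0 x = 0 ∧ deriv (fun τ => w τ x) 0 = 0 := by
    intro x hx
    obtain ⟨h1, h2⟩ := hdat x hx
    refine ⟨by simp [hw, h1], ?_⟩
    show deriv (fun τ => ψ τ x - φ τ x) 0 = 0
    rw [deriv_fun_sub (hdψ 0 x) (hdφ 0 x), h2, sub_self]
  -- the majorant
  set K : ℝ := 2 * Real.sqrt 2 * D * Real.sqrt E with hK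
  have hK0 : 0 ≤ K := by positivity
  set m : ℝ → ℝ := fun τ => K * (c + |τ|) ^ (-(3 / 2 : ℝ)) with hm
  have hbase : Continuous fun τ : ℝ => c + |τ| := continuous_const.add continuous_abs
  have hbase0 : ∀ τ : ℝ, 0 < c + |τ| := fun τ => by have := abs_nonneg τ; linarith
  have hmc : Continuous m :=
    continuous_const.mul (hbase.rpow_const fun τ => Or.inl (hbase0 τ).ne')
  have hmb : ∀ τ, 0 ≤ τ → ∀ b, 0 + τ ≤ b - τ →
      Real.sqrt (∫ x in (0 + τ)..(b - τ), Fw τ x ^ 2) ≤ m τ := by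
    intro τ hτ b hb
    rw [zero_add] at hb ⊢
    have hcτ : 0 < c + τ := by linarith
    have hcongr : (∫ x in τ..(b - τ), Fw τ x ^ 2)
        = ∫ x in τ..(b - τ), ((V₀ x - V x) * ψ τ x) ^ 2 := by
      refine intervalIntegral.integral_congr fun x hx => ?_
      rw [uIcc_of_le hb] at hx
      show Fw τ x ^ 2 = ((V₀ x - V x) * ψ τ x) ^ 2
      rw [hFw_cone τ x (by rw [abs_of_nonneg hτ]; exact hx.1)]
    rw [hcongr]
    have h := far_model_source_sq_le hV hV0 hV₀ hψ hX hXR hE hclose hvan hEψ hτ b hb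
    have hsq : 8 * D ^ 2 * (R₀ / 2 + τ) ^ (-(3 : ℝ)) * E = (K * (c + τ) ^ (-(3 / 2 : ℝ))) ^ 2 := by
      rw [← hc, hK, mul_pow, mul_pow, mul_pow, mul_pow, Real.sq_sqrt hE,
        Real.sq_sqrt (by norm_num : (0:ℝ) ≤ 2), ← rpow_natCast ((c + τ) ^ (-(3 / 2 : ℝ))) 2,
        ← rpow_mul hcτ.le]
      norm_num
      ring
    calc Real.sqrt (∫ x in τ..(b - τ), ((V₀ x - V x) * ψ τ x) ^ 2)
        ≤ Real.sqrt (8 * D ^ 2 * (R₀ / 2 + τ) ^ (-(3 : ℝ)) * E) := Real.sqrt_le_sqrt h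
      _ = K * (c + τ) ^ (-(3 / 2 : ℝ)) := by rw [hsq, Real.sqrt_sq (by positivity)]
      _ = m τ := by simp only [hm, abs_of_nonneg hτ]
  -- the Duhamel bound on the cone `{x > 0 + t}`
  have hD' := wave1D_farCone_energy_le_of_zero_data hV₀ hV₀0 hFwc hwC hwsol (a := 0) hzero hmc hmb ht
  rw [zero_add] at hD'
  refine hD'.trans (ENNReal.ofReal_le_ofReal ?_)
  -- `∫_0^t m ≤ 2 K c^{-1/2}`
  have hint : (∫ τ in (0:ℝ)..t, m τ) ≤ 2 * K * c ^ (-(1 / 2 : ℝ)) := by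
    have e1 : (∫ τ in (0:ℝ)..t, m τ) = K * ∫ τ in (0:ℝ)..t, (c + τ) ^ (-(3 / 2 : ℝ)) := by
      rw [← intervalIntegral.integral_const_mul]
      refine intervalIntegral.integral_congr fun τ hτ => ?_
      rw [uIcc_of_le ht] at hτ
      simp only [hm, abs_of_nonneg hτ.1]
    rw [e1, intervalIntegral.integral_comp_add_left (fun u : ℝ => u ^ (-(3 / 2 : ℝ))) c, add_zero,
      integral_rpow (Or.inr ⟨by norm_num, by
        rw [uIcc_of_le (by linarith)]; exact fun h => by linarith [h.1]⟩)]
    have h1 : 0 ≤ (c + t) ^ (-(3 / 2 : ℝ) + 1) := rpow_nonneg (by linarith) _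
    have e2 : ((c + t) ^ (-(3 / 2 : ℝ) + 1) - c ^ (-(3 / 2 : ℝ) + 1)) / (-(3 / 2 : ℝ) + 1)
        = 2 * (c ^ (-(1 / 2 : ℝ)) - (c + t) ^ (-(3 / 2 : ℝ) + 1)) := by
      rw [show (-(3 / 2 : ℝ) + 1) = -(1 / 2 : ℝ) by norm_num]
      field_simp
      ring
    rw [e2]
    nlinarith [rpow_nonneg hc0.le (-(1 / 2 : ℝ))]
  have hint0 : 0 ≤ ∫ τ in (0:ℝ)..t, m τ :=
    intervalIntegral.integral_nonneg ht fun τ _ => by positivity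
  have hcinv : (c ^ (-(1 / 2 : ℝ))) ^ 2 = c⁻¹ := by
    rw [← rpow_natCast (c ^ (-(1 / 2 : ℝ))) 2, ← rpow_mul hc0.le]
    norm_num
    rw [rpow_neg_one]
  calc 4 * (∫ τ in (0:ℝ)..t, m τ) ^ 2 ≤ 4 * (2 * K * c ^ (-(1 / 2 : ℝ))) ^ 2 := by
        gcongr
    _ = 16 * K ^ 2 * (c ^ (-(1 / 2 : ℝ))) ^ 2 := by ring
    _ = 256 * D ^ 2 * E / R₀ := by
        rw [hcinv, hK, mul_pow, mul_pow, mul_pow, Real.sq_sqrt hE,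
          Real.sq_sqrt (by norm_num : (0:ℝ) ≤ 2), hc]
        field_simp
        ring

omit hκ0 hκ1 hlow in
/-- **Far-cone comparison at apex `0`, forward in time.** For every `t ≥ 0`,
`∫⁻_{x>t} e_{V₀}[φ](t) ≤ (2/(1−κ)) ∫⁻_{x>t} e_V[ψ](t) + 512 D² E / R₀`. [folklore] -/
theorem far_model_comparison_forward (hκ0 : 0 ≤ κ) (hκ1 : κ < 1)
    (hlow : ∀ x, X ≤ x → (1 - κ) * V₀ x ≤ V x) {t : ℝ} (ht : 0 ≤ t) :
    ∫⁻ x in Ioi t, ENNReal.ofReal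
        (deriv (fun τ => φ τ x) t ^ 2 + deriv (φ t) x ^ 2 + V₀ x * φ t x ^ 2)
      ≤ ENNReal.ofReal (2 / (1 - κ)) * (∫⁻ x in Ioi t, ENNReal.ofReal
          (deriv (fun τ => ψ τ x) t ^ 2 + deriv (ψ t) x ^ 2 + V x * ψ t x ^ 2))
        + ENNReal.ofReal (512 * D ^ 2 * E / R₀) := by
  have hk : 0 < 1 - κ := by linarith
  -- `φ = ψ − w`
  set w : ℝ → ℝ → ℝ := fun t x => ψ t x - φ t x with hw
  have hwC : ContDiff ℝ 2 (Function.uncurry w) := hψ.sub hφ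
  have hsplit := wave1D_energy_lintegral_sub_le hV₀ hV₀0 hψ hwC (Ioi t) t
  have hL : ∫⁻ x in Ioi t, ENNReal.ofReal
        (deriv (fun τ => φ τ x) t ^ 2 + deriv (φ t) x ^ 2 + V₀ x * φ t x ^ 2)
      = ∫⁻ x in Ioi t, ENNReal.ofReal
        (deriv (fun τ => ψ τ x - w τ x) t ^ 2 + deriv (fun y => ψ t y - w t y) x ^ 2
          + V₀ x * (ψ t x - w t x) ^ 2) := by
    refine lintegral_congr fun x => ?_
    have e1 : (fun τ => ψ τ x - w τ x) = fun τ => φ τ x := by funext τ; simp [hw]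
    have e2 : (fun y => ψ t y - w t y) = φ t := by funext y; simp [hw]
    have e3 : ψ t x - w t x = φ t x := by simp [hw]
    rw [e1, e2, e3]
  rw [hL]
  -- the Duhamel term
  have hW := far_model_duhamel hV hV0 hV₀ hV₀0 hψ hψsol hφ hφsol hX hXR hD hE hclose hvan hdat hEψ ht
  -- the `ψ`-term: pointwise comparison of densities
  have hmeas : Measurable fun x => ENNReal.ofReal
      (deriv (fun τ => ψ τ x) t ^ 2 + deriv (ψ t) x ^ 2 + V x * ψ t x ^ 2) :=
    ((continuous_wave1D_energyDensity hV hψ).comp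
      (continuous_const.prodMk continuous_id)).measurable.ennreal_ofReal
  have hA : ∫⁻ x in Ioi t, ENNReal.ofReal
      (deriv (fun τ => ψ τ x) t ^ 2 + deriv (ψ t) x ^ 2 + V₀ x * ψ t x ^ 2)
      ≤ ENNReal.ofReal ((1 - κ)⁻¹) * ∫⁻ x in Ioi t, ENNReal.ofReal
          (deriv (fun τ => ψ τ x) t ^ 2 + deriv (ψ t) x ^ 2 + V x * ψ t x ^ 2) := by
    rw [← lintegral_const_mul _ hmeas]
    refine setLIntegral_mono (hmeas.const_mul _) fun x hx => ?_
    rw [← ENNReal.ofReal_mul (by positivity)]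
    exact ENNReal.ofReal_le_ofReal (far_model_density_le hXR hvan hκ0 hκ1 hlow ht hx)
  have e2 : (2 : ℝ≥0∞) = ENNReal.ofReal 2 := by simp
  calc ∫⁻ x in Ioi t, ENNReal.ofReal
        (deriv (fun τ => ψ τ x - w τ x) t ^ 2 + deriv (fun y => ψ t y - w t y) x ^ 2
          + V₀ x * (ψ t x - w t x) ^ 2)
      ≤ (2 * ∫⁻ x in Ioi t, ENNReal.ofReal
          (deriv (fun τ => ψ τ x) t ^ 2 + deriv (ψ t) x ^ 2 + V₀ x * ψ t x ^ 2))
        + 2 * ∫⁻ x in Ioi t, ENNReal.ofReal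
          (deriv (fun τ => w τ x) t ^ 2 + deriv (w t) x ^ 2 + V₀ x * w t x ^ 2) := hsplit
    _ ≤ 2 * (ENNReal.ofReal ((1 - κ)⁻¹) * ∫⁻ x in Ioi t, ENNReal.ofReal
          (deriv (fun τ => ψ τ x) t ^ 2 + deriv (ψ t) x ^ 2 + V x * ψ t x ^ 2))
        + 2 * ENNReal.ofReal (256 * D ^ 2 * E / R₀) := by
        gcongr
    _ = ENNReal.ofReal (2 / (1 - κ)) * (∫⁻ x in Ioi t, ENNReal.ofReal
          (deriv (fun τ => ψ τ x) t ^ 2 + deriv (ψ t) x ^ 2 + V x * ψ t x ^ 2))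
        + ENNReal.ofReal (512 * D ^ 2 * E / R₀) := by
        have c1 : (2 : ℝ≥0∞) * ENNReal.ofReal ((1 - κ)⁻¹) = ENNReal.ofReal (2 / (1 - κ)) := by
          rw [e2, ← ENNReal.ofReal_mul (by norm_num), div_eq_mul_inv]
        have c2 : (2 : ℝ≥0∞) * ENNReal.ofReal (256 * D ^ 2 * E / R₀)
            = ENNReal.ofReal (512 * D ^ 2 * E / R₀) := by
          rw [e2, ← ENNReal.ofReal_mul (by norm_num)]
          congr 1
          ring
        rw [← mul_assoc, c1, c2]

end Forward

end Literature.Analysis.PDE
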